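import Summits.ResolutionOfSingularities.ResolutionOfSingularities.Theorems.RadicialJungCleanModelsSufficeChartsStalkIso
import Summits.ResolutionOfSingularities.ResolutionOfSingularities.Theorems.RadicialJungCleanModelsSufficeChartsPoint
import Literature.AlgebraicGeometry.Resolution.CanonicalResolutionProofs

/-!
# Route `RadicialJung`, crux `CleanModelsSuffice`, line `Sketch`: the normalisation-singular
# locus of `V` is closed

Helper for the exceptionalisation game of the skeleton of
`Summit.ResolutionOfSingularities.ResolutionOfSingularities.Theses.RadicialJung.CleanModelsSuffice`
(stmt-ResolutionOfSingularities-15883). For an integral scheme `V` locally of finite type over a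
field `k` and a degree-`p` extension `L` of `K(V)` such that every `integralClosure 𝒪_{V,w} L` is
local, the set `S = {w ∈ V | integralClosure 𝒪_{V,w} L is not regular}` is closed: by
`exists_ringEquiv_stalk_integralClosure` these integral closures are the stalks of
`V^L = normalizationIn V L` at the points over `w`, so `S = ι '' (Reg V^L)ᶜ` for the finite (hence
closed and surjective) map `ι = normalizationInι V L`, and `Reg V^L` is open because `V^L` is
locally of finite type over `k` (`isOpen_regularLocus_of_locallyOfFiniteType_field`).
-/

noncomputable section

set_option linter.dupNamespace false -- mandated namespace of this single-conjunct summit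

open CategoryTheory AlgebraicGeometry TopologicalSpace
open Literature.AlgebraicGeometry.Resolution

namespace Summit.ResolutionOfSingularities.ResolutionOfSingularities.Theorems.RadicialJung.CleanModelsSuffice

attribute [local instance] stalkAlgebra isScalarTower_stalkAlgebra

/-- `V^L → V` is surjective: it is integral, hence closed, and dominant. [folklore] -/
theorem surjective_normalizationInι_base (V : Scheme.{0}) [IsIntegral V] (L : Type) [Field L]
    [Algebra V.functionField L] : Function.Surjective (normalizationInι V L) := by
  have hcl : IsClosed (Set.range (normalizationInι V L)) :=
    (normalizationInι V L).isClosedMap.isClosed_range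
  have hd : Dense (Set.range (normalizationInι V L)) := (normalizationInι V L).denseRange
  exact Set.range_eq_univ.mp (by rw [← hd.closure_eq, hcl.closure_eq])

/-- **The normalisation-singular locus is closed.** For `V` integral and locally of finite type
over a field `k`, `L/K(V)` of degree `p` (prime) and all `integralClosure 𝒪_{V,w} L` local, the
set of `w ∈ V` with `integralClosure 𝒪_{V,w} L` not regular is closed: it is the image under the
finite map `V^L → V` of the (closed) singular locus of `V^L`. [folklore] -/
theorem isClosed_setOf_not_isRegularLocalRing_integralClosure (p : ℕ) (hp : p.Prime) (k : Type)
    [Field k] (V : Scheme.{0}) [IsIntegral V] (f : V ⟶ Spec (.of k)) [LocallyOfFiniteType f]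
    (L : Type) [Field L] [Algebra V.functionField L] (hdeg : Module.finrank V.functionField L = p)
    (hloc : ∀ w : V, IsLocalRing (integralClosure (V.presheaf.stalk w) L)) :
    IsClosed {w : V | ¬ IsRegularLocalRing (integralClosure (V.presheaf.stalk w) L)} := by
  haveI : FiniteDimensional V.functionField L :=
    Module.finite_of_finrank_pos (by rw [hdeg]; exact hp.pos)
  haveI : IsFinite (normalizationInι V L) := isFinite_normalizationInι V L f
  -- the regular locus of `V^L` is open (`V^L` is locally of finite type over `k`)
  have hopen : IsOpen (Scheme.regularLocus (normalizationIn V L)) :=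
    isOpen_regularLocus_of_locallyOfFiniteType_field (normalizationInι V L ≫ f)
  -- our set is the image of its complement under the closed surjective map `ι`
  have heq : {w : V | ¬ IsRegularLocalRing (integralClosure (V.presheaf.stalk w) L)} =
      normalizationInι V L '' (Scheme.regularLocus (normalizationIn V L))ᶜ := by
    ext w
    constructor
    · intro hw
      obtain ⟨x, rfl⟩ := surjective_normalizationInι_base V L w
      refine ⟨x, fun hx => ?_, rfl⟩
      rw [Scheme.mem_regularLocus] at hx
      haveI := hloc (normalizationInι V L x)
      obtain ⟨e, -⟩ := exists_ringEquiv_stalk_integralClosure_zero V L x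
      exact hw (IsRegularLocalRing.of_ringEquiv e)
    · rintro ⟨x, hx, rfl⟩ hw
      refine hx ?_
      rw [Scheme.mem_regularLocus]
      haveI := hloc (normalizationInι V L x)
      haveI := hw
      obtain ⟨e, -⟩ := exists_ringEquiv_stalk_integralClosure_zero V L x
      exact IsRegularLocalRing.of_ringEquiv e.symm
  rw [heq]
  exact (normalizationInι V L).isClosedMap _ hopen.isClosed_compl

end Summit.ResolutionOfSingularities.ResolutionOfSingularities.Theorems.RadicialJung.CleanModelsSuffice

end
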